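import Mathlib
import HarnessLib
import Summits.Ventures.LatticeQCDFlow.Exactness.SUNLeapfrogEnergyError
import Summits.Ventures.LatticeQCDFlow.Exactness.SUNMomentumLawMoments

/-!
# THE MEAN ACCEPTANCE OF THE ENGINE'S `n`-STEP `SU(N)` LEAPFROG PROPOSAL IN GENERAL COORDINATES IS AT LEAST `1 − O(nε²)`, EXPLICITLY: the pointwise energy-error law averaged over the Gaussian momentum refresh, from every configuration

HONEST FRAMING: exact (Metropolis-corrected) sampling algorithms for lattice gauge theory;
figures of merit are autocorrelation/cost numbers at stated couplings and volumes; no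
continuum-physics claim.

Venture `LatticeQCDFlow` (cell pub-lqcd), topic `Exactness`; FANOUT row 14 (`eng-flowhmc`, engine
`latflow.fthmc`, family B; the row's test battery reports the MEAN Metropolis acceptance of the field-transformed
leapfrog proposal — this file bounds that column from below on the `SU(N)` rung of rows 21–26, `SU(3)` included).  The
general-coordinates twin of `SU2LeapfrogMeanAcceptance` / `U1LeapfrogMeanAcceptance`.  NEW WORK of the cell over the
tree: `SUNLeapfrogEnergyError` (`abs_sunLeapfrogProposalN_energy_error_le`: for ANY action with a `B`-represented,
bounded, matrix-sup-Lipschitz force field `D` and the consistent half kick `g = −D/(4κ)`, the energy error of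
`Ψ_n = sunLeapfrogProposalN ι hι ε g n` is `≤ n·βK·N²C_ι|ε|(‖p‖ + b)(Σ_l‖p_l‖ + c₁ + c₂)` pointwise,
`b = (2n+1)D_max/(4κ)`, `c₁ = (2n+1)|L|D_max/(4κ)`, `c₂ = |L|D_max/(8κ)`), `SUNMomentumLawMoments`
(`E Σ_l‖p_l‖ ≤ |L|√(d/(2κ))`, `E (Σ_l‖p_l‖)² ≤ |L|²·d/(2κ)` under the refresh `sunMomentumLaw μ (κΣ‖p_l‖²)` for ANY
additive Haar measure `μ` on ANY `d`-dimensional coordinate space), row 9's `SUNMultiStepLeapfrogHMC`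
(`measurable_sunLeapfrogProposalN`); nothing is cited as a fact; no number.  SETTING as in `SUNLeapfrogEnergyError`, with
the pairing normalised to the norm, `B(x,x) = ‖x‖²` (an inner-product norm read through `B = ⟪·,·⟫`; then the kinetic
term `κΣ_l B(p_l,p_l)` IS `κΣ_l‖p_l‖²`, the exponent of the refresh law).

* `sunMomentum_pi_norm_le_sum_norm` — `‖p‖_∞ ≤ Σ_l‖p_l‖`.
* **`sunLeapfrogProposalN_meanAcceptance_ge`** — for ANY measurable action `S` with `a ↦ S(e_ε(a)·W)` differentiable
  at `0`, a MEASURABLE represented force field `D` with `‖D(W)_l‖ ≤ D_max`, `‖D(W) − D(W')‖ ≤ K‖coeConfig W − coeConfig W'‖`,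
  `κ > 0` and the consistent half kick: from EVERY configuration `q`,
  `∫ min(1, e^{−ΔH(q,p)}) d(sunMomentumLaw μ (κΣ‖·‖²))(p) ≥ 1 − n·βK·N²C_ι|ε|·(|L|²·d/(2κ) + (b + c₁ + c₂)·|L|√(d/(2κ)) + b(c₁ + c₂))`
  — the refresh-averaged acceptance of the exact kernel's proposal is `1 − O(nε²)` once `K, D_max = O(ε)`, UNIFORMLY in
  `q`, hence also in equilibrium; quadratic in the number of links through `E(Σ‖p_l‖)²` (an honest pointwise-law bound);
* **`sunLeapfrogProposalN_meanAcceptance_ge_integral`** — hence for EVERY probability law `ν` of the configuration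
  (initial or invariant) the `ν ⊗ refresh`-averaged acceptance obeys the same bound.

NOT CLAIMED: the equilibrium average as an identity; the Gaussian/erfc model of `ΔH`; optimal constants; which `B`, `D`
the engine realises in its coordinates `sunCoordι` (row 9's dictionary); the members' force fields on the `SU(N)` rung
(not yet typed bounded/Lipschitz for `N ≥ 3`); floating point; any number.
-/

noncomputable section

namespace Summit.Ventures.LatticeQCDFlow.Exactness

open Set Function MeasureTheory NormedSpace
open scoped Matrix Matrix.Norms.Operator ENNReal

set_option backward.isDefEq.respectTransparency false

section MeanAcceptance

variable {n : Type*} [Fintype n] [DecidableEq n]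
variable {E : Type*} [NormedAddCommGroup E] [NormedSpace ℝ E] [FiniteDimensional ℝ E] [Nontrivial E]
  [MeasurableSpace E] [BorelSpace E] (μ : Measure E) [μ.IsAddHaarMeasure]
variable (ι : E →ₗ[ℝ] Matrix n n ℂ) (hι : ∀ a, (ι a)ᴴ = -ι a ∧ (ι a).trace = 0)
variable (B : E →ₗ[ℝ] E →ₗ[ℝ] ℝ)
variable {L : Type*} [Fintype L]

omit [NormedSpace ℝ E] [FiniteDimensional ℝ E] [Nontrivial E] [MeasurableSpace E] [BorelSpace E] in
/-- The sup norm of the momenta is at most the sum of the link norms. -/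
theorem sunMomentum_pi_norm_le_sum_norm (p : L → E) : ‖p‖ ≤ ∑ l, ‖p l‖ :=
  (pi_norm_le_iff_of_nonneg (Finset.sum_nonneg fun m _ => norm_nonneg (p m))).2 fun l =>
    Finset.single_le_sum (fun m _ => norm_nonneg (p m)) (Finset.mem_univ l)

/-- **THE MEAN ACCEPTANCE OF THE ENGINE'S `n`-STEP `SU(N)` PROPOSAL IS AT LEAST `1 − O(nε²)`, EXPLICITLY.**  For ANY
measurable action `S` with `a ↦ S(e_ε(a)·W)` differentiable at `0`, a measurable force field `D` representing its
differential through a symmetric pairing `B` with `B(x,x) = ‖x‖²`, `|B(x,y)| ≤ β‖x‖‖y‖`, `‖D(W)_l‖ ≤ D_max`,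
`‖D(W) − D(W')‖ ≤ K‖coeConfig W − coeConfig W'‖`, coordinates with `‖ι x‖ ≤ C_ι‖x‖`, `κ > 0` and the consistent half
kick `g = −D/(4κ)`: from EVERY configuration `q`, the acceptance probability of `Ψ_n = sunLeapfrogProposalN ι hι ε g n`
averaged over the momentum refresh `p ∼ Z⁻¹e^{−κΣ‖p_l‖²}dμ^{⊗L}` satisfies
`∫ min(1, e^{−ΔH(q,p)}) dp ≥ 1 − n·βK·N²C_ι|ε|·(|L|²·d/(2κ) + (b + c₁ + c₂)·|L|√(d/(2κ)) + b(c₁ + c₂))` with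
`b = (2n+1)D_max/(4κ)`, `c₁ = (2n+1)|L|D_max/(4κ)`, `c₂ = |L|D_max/(8κ)`. -/
theorem sunLeapfrogProposalN_meanAcceptance_ge {Cι : ℝ} (hC0 : 0 ≤ Cι) (hCι : ∀ x : E, ‖ι x‖ ≤ Cι * ‖x‖)
    (S : (L → Matrix.specialUnitaryGroup n ℂ) → ℝ) (hS : Measurable S) (ε κ : ℝ) (hκ : 0 < κ)
    (hd : ∀ W : L → Matrix.specialUnitaryGroup n ℂ, DifferentiableAt ℝ (fun a : L → E => S (sunExpDrift ι hι ε a * W)) 0)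
    (hBs : ∀ x y : E, B x y = B y x) (hBn : ∀ x : E, B x x = ‖x‖ ^ 2) {β : ℝ} (hβ0 : 0 ≤ β)
    (hBβ : ∀ x y : E, |B x y| ≤ β * ‖x‖ * ‖y‖)
    (D g : (L → Matrix.specialUnitaryGroup n ℂ) → L → E) (hDm : Measurable D)
    (hD : ∀ (W : L → Matrix.specialUnitaryGroup n ℂ) (δ : L → E),
      fderiv ℝ (fun a : L → E => S (sunExpDrift ι hι ε a * W)) 0 δ = ∑ l, B (D W l) (δ l))
    {Dmax K : ℝ} (hD0 : 0 ≤ Dmax) (hK0 : 0 ≤ K)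
    (hDb : ∀ (W : L → Matrix.specialUnitaryGroup n ℂ) (l : L), ‖D W l‖ ≤ Dmax)
    (hDK : ∀ W W' : L → Matrix.specialUnitaryGroup n ℂ, ‖D W - D W'‖ ≤ K * ‖coeConfig W - coeConfig W'‖)
    (hg : ∀ W l, g W l = -(1 / (4 * κ)) • D W l)
    (q : L → Matrix.specialUnitaryGroup n ℂ) (N : ℕ) :
    1 - N * (β * K * ((Fintype.card n : ℝ) ^ 2 * Cι * |ε|)) *
        ((Fintype.card L : ℝ) ^ 2 * (Module.finrank ℝ E / (2 * κ)) +
          ((2 * N + 1) * (Dmax / (4 * κ)) + (2 * N + 1) * (Fintype.card L * (Dmax / (4 * κ))) + Fintype.card L * Dmax / (8 * κ)) *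
            (Fintype.card L * Real.sqrt (Module.finrank ℝ E / (2 * κ))) +
          (2 * N + 1) * (Dmax / (4 * κ)) * ((2 * N + 1) * (Fintype.card L * (Dmax / (4 * κ))) + Fintype.card L * Dmax / (8 * κ))) ≤
      ∫ p, min 1 (Real.exp (-((S (sunLeapfrogProposalN ι hι ε g N (q, p)).1 +
          κ * ∑ l, ‖(sunLeapfrogProposalN ι hι ε g N (q, p)).2 l‖ ^ 2) - (S q + κ * ∑ l, ‖p l‖ ^ 2))))
        ∂(sunMomentumLaw (L := L) μ fun p => κ * ∑ l, ‖p l‖ ^ 2) := by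
  haveI := isProbabilityMeasure_sunMomentumLaw_normSq (L := L) μ hκ
  -- abbreviations
  set b : ℝ := (2 * N + 1) * (Dmax / (4 * κ)) with hb
  set c₁ : ℝ := (2 * N + 1) * (Fintype.card L * (Dmax / (4 * κ))) with hc₁
  set c₂ : ℝ := Fintype.card L * Dmax / (8 * κ) with hc₂
  set α : ℝ := b + c₁ + c₂ with hα
  set C : ℝ := β * K * ((Fintype.card n : ℝ) ^ 2 * Cι * |ε|) with hC
  have hb0 : 0 ≤ b := by rw [hb]; positivity
  have hc₁0 : 0 ≤ c₁ := by rw [hc₁]; positivity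
  have hc₂0 : 0 ≤ c₂ := by rw [hc₂]; positivity
  have hα0 : 0 ≤ α := by rw [hα]; positivity
  have hC0' : 0 ≤ C := by rw [hC]; positivity
  set ΔH : (L → E) → ℝ := fun p =>
    (S (sunLeapfrogProposalN ι hι ε g N (q, p)).1 + κ * ∑ l, ‖(sunLeapfrogProposalN ι hι ε g N (q, p)).2 l‖ ^ 2) -
      (S q + κ * ∑ l, ‖p l‖ ^ 2) with hΔH
  -- `1 − |x| ≤ min(1, e^{−x})`
  have hacc : ∀ x : ℝ, 1 - |x| ≤ min 1 (Real.exp (-x)) := by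
    intro x
    rcases le_or_gt x 0 with hx | hx
    · rw [min_eq_left ((Real.one_le_exp_iff).2 (by linarith))]
      linarith [abs_nonneg x]
    · rw [abs_of_pos hx]
      refine le_min (by linarith) ?_
      linarith [Real.add_one_le_exp (-x)]
  -- the pointwise energy-error law, as a polynomial in Σ_l ‖p_l‖
  have hpt : ∀ p : L → E, |ΔH p| ≤ N * C * ((∑ l, ‖p l‖) ^ 2 + α * ∑ l, ‖p l‖ + b * (c₁ + c₂)) := by
    intro p
    have h := abs_sunLeapfrogProposalN_energy_error_le ι hι B hC0 hCι S ε κ hκ hd hBs hβ0 hBβ D g hD hD0 hK0 hDb hDK hg q p N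
    simp only [hBn] at h
    have hs := sunMomentum_pi_norm_le_sum_norm p
    have hs0 : 0 ≤ ∑ l, ‖p l‖ := Finset.sum_nonneg fun l _ => norm_nonneg _
    refine h.trans ?_
    rw [hα, hC]
    have h1 : β * K * ((Fintype.card n : ℝ) ^ 2 * Cι * |ε| * (‖p‖ + (2 * N + 1) * (Dmax / (4 * κ)))) ≤
        β * K * ((Fintype.card n : ℝ) ^ 2 * Cι * |ε| * (∑ l, ‖p l‖ + b)) := by
      rw [hb]; gcongr
    have h2 : (0 : ℝ) ≤ ∑ l, ‖p l‖ + (2 * N + 1) * (Fintype.card L * (Dmax / (4 * κ))) + Fintype.card L * Dmax / (8 * κ) := by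
      positivity
    calc (N : ℝ) * (β * K * ((Fintype.card n : ℝ) ^ 2 * Cι * |ε| * (‖p‖ + (2 * N + 1) * (Dmax / (4 * κ)))) *
          (∑ l, ‖p l‖ + (2 * N + 1) * (Fintype.card L * (Dmax / (4 * κ))) + Fintype.card L * Dmax / (8 * κ)))
        ≤ N * (β * K * ((Fintype.card n : ℝ) ^ 2 * Cι * |ε| * (∑ l, ‖p l‖ + b)) *
          (∑ l, ‖p l‖ + (2 * N + 1) * (Fintype.card L * (Dmax / (4 * κ))) + Fintype.card L * Dmax / (8 * κ))) := by
          gcongr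
      _ = N * (β * K * ((Fintype.card n : ℝ) ^ 2 * Cι * |ε|)) * ((∑ l, ‖p l‖) ^ 2 + (b + c₁ + c₂) * ∑ l, ‖p l‖ + b * (c₁ + c₂)) := by
          rw [hc₁, hc₂]; ring
  -- measurability of ΔH and integrability of both sides
  have hgfun : g = fun W l => -(1 / (4 * κ)) • D W l := funext fun W => funext fun l => hg W l
  have hgm : Measurable g := by rw [hgfun]; exact hDm.const_smul (-(1 / (4 * κ)))
  have hΨ : Measurable (⇑(sunLeapfrogProposalN ι hι ε g N)) := measurable_sunLeapfrogProposalN ι hι ε N hgm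
  have hT : Measurable fun p : L → E => κ * ∑ l, ‖p l‖ ^ 2 := measurable_normSqKinetic κ
  have hΔm : Measurable ΔH := by
    rw [hΔH]
    have hq : Measurable fun p : L → E => sunLeapfrogProposalN ι hι ε g N (q, p) := hΨ.comp measurable_prodMk_left
    exact ((hS.comp (measurable_fst.comp hq)).add (hT.comp (measurable_snd.comp hq))).sub (measurable_const.add hT)
  have hacc_int : Integrable (fun p => min 1 (Real.exp (-ΔH p))) (sunMomentumLaw (L := L) μ fun p => κ * ∑ l, ‖p l‖ ^ 2) := by
    refine (integrable_const (1 : ℝ)).mono' (measurable_const.min (hΔm.neg.exp)).aestronglyMeasurable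
      (Filter.Eventually.of_forall fun p => ?_)
    rw [Real.norm_eq_abs, abs_of_nonneg (le_min zero_le_one (Real.exp_pos _).le)]
    exact min_le_left _ _
  have hint1 : Integrable (fun p : L → E => ∑ l, ‖p l‖) (sunMomentumLaw (L := L) μ fun p => κ * ∑ l, ‖p l‖ ^ 2) :=
    integrable_finsetSum _ fun l _ => by simpa only [pow_one] using integrable_norm_apply_pow_sunMomentumLaw (L := L) μ hκ 1 l
  have hint2 : Integrable (fun p : L → E => (∑ l, ‖p l‖) ^ 2) (sunMomentumLaw (L := L) μ fun p => κ * ∑ l, ‖p l‖ ^ 2) := by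
    have hint2' : Integrable (fun p : L → E => (Fintype.card L : ℝ) * ∑ l, ‖p l‖ ^ 2)
        (sunMomentumLaw (L := L) μ fun p => κ * ∑ l, ‖p l‖ ^ 2) :=
      (integrable_finsetSum _ fun l _ => integrable_norm_apply_pow_sunMomentumLaw (L := L) μ hκ 2 l).const_mul _
    refine hint2'.mono' ((Finset.measurable_sum _ fun l _ => (measurable_pi_apply l).norm).pow_const 2).aestronglyMeasurable
      (Filter.Eventually.of_forall fun p => ?_)
    rw [Real.norm_eq_abs, abs_of_nonneg (sq_nonneg _)]
    have h := sq_sum_le_card_mul_sum_sq (s := Finset.univ) (f := fun l => ‖p l‖)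
    simpa only [Finset.card_univ] using h
  have hαs : Integrable (fun p : L → E => α * ∑ l, ‖p l‖) (sunMomentumLaw (L := L) μ fun p => κ * ∑ l, ‖p l‖ ^ 2) :=
    hint1.const_mul α
  have h2α : Integrable (fun p : L → E => (∑ l, ‖p l‖) ^ 2 + α * ∑ l, ‖p l‖) (sunMomentumLaw (L := L) μ fun p => κ * ∑ l, ‖p l‖ ^ 2) :=
    hint2.add hαs
  have hq3 : Integrable (fun p : L → E => (∑ l, ‖p l‖) ^ 2 + α * ∑ l, ‖p l‖ + b * (c₁ + c₂))
      (sunMomentumLaw (L := L) μ fun p => κ * ∑ l, ‖p l‖ ^ 2) := h2α.add (integrable_const _)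
  have hCq : Integrable (fun p : L → E => N * C * ((∑ l, ‖p l‖) ^ 2 + α * ∑ l, ‖p l‖ + b * (c₁ + c₂)))
      (sunMomentumLaw (L := L) μ fun p => κ * ∑ l, ‖p l‖ ^ 2) := hq3.const_mul _
  have hpoly_int : Integrable (fun p : L → E => 1 - N * C * ((∑ l, ‖p l‖) ^ 2 + α * ∑ l, ‖p l‖ + b * (c₁ + c₂)))
      (sunMomentumLaw (L := L) μ fun p => κ * ∑ l, ‖p l‖ ^ 2) := (integrable_const _).sub hCq
  -- integrate the pointwise bound
  have hmono : ∫ p, (1 - N * C * ((∑ l, ‖p l‖) ^ 2 + α * ∑ l, ‖p l‖ + b * (c₁ + c₂)))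
        ∂(sunMomentumLaw (L := L) μ fun p => κ * ∑ l, ‖p l‖ ^ 2) ≤
      ∫ p, min 1 (Real.exp (-ΔH p)) ∂(sunMomentumLaw (L := L) μ fun p => κ * ∑ l, ‖p l‖ ^ 2) :=
    integral_mono hpoly_int hacc_int fun p => ((sub_le_sub_left (hpt p) 1).trans (hacc (ΔH p)))
  -- evaluate the left-hand side with the moments of the refresh law
  have hlhs : ∫ p, (1 - N * C * ((∑ l, ‖p l‖) ^ 2 + α * ∑ l, ‖p l‖ + b * (c₁ + c₂)))
        ∂(sunMomentumLaw (L := L) μ fun p => κ * ∑ l, ‖p l‖ ^ 2) =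
      1 - N * C * (∫ p, (∑ l, ‖p l‖) ^ 2 ∂(sunMomentumLaw (L := L) μ fun p => κ * ∑ l, ‖p l‖ ^ 2) +
        α * ∫ p, ∑ l, ‖p l‖ ∂(sunMomentumLaw (L := L) μ fun p => κ * ∑ l, ‖p l‖ ^ 2) + b * (c₁ + c₂)) := by
    rw [integral_sub (integrable_const _) hCq, integral_const, integral_const_mul, integral_add h2α (integrable_const _),
      integral_add hint2 hαs, integral_const_mul, integral_const]
    simp only [probReal_univ, smul_eq_mul, one_mul]
  have hE2 := integral_sq_sum_norm_sunMomentumLaw_le (L := L) μ hκ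
  have hE1 := integral_sum_norm_sunMomentumLaw_le (L := L) μ hκ
  have hfin : 1 - N * C * ((Fintype.card L : ℝ) ^ 2 * (Module.finrank ℝ E / (2 * κ)) +
        α * (Fintype.card L * Real.sqrt (Module.finrank ℝ E / (2 * κ))) + b * (c₁ + c₂)) ≤
      1 - N * C * (∫ p, (∑ l, ‖p l‖) ^ 2 ∂(sunMomentumLaw (L := L) μ fun p => κ * ∑ l, ‖p l‖ ^ 2) +
        α * ∫ p, ∑ l, ‖p l‖ ∂(sunMomentumLaw (L := L) μ fun p => κ * ∑ l, ‖p l‖ ^ 2) + b * (c₁ + c₂)) := by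
    have hcoef : 0 ≤ (N : ℝ) * C := by positivity
    nlinarith [hE2, hE1, hcoef, mul_nonneg hcoef hα0]
  have hgoal := (hfin.trans (hlhs.symm.le)).trans hmono
  rw [hα, hb, hc₁, hc₂, hC] at hgoal
  simpa only [hΔH] using hgoal

/-- **… and therefore in ANY law of the configuration** (an initial law, or the invariant law in equilibrium): for
every probability measure `ν` on the configurations the `ν ⊗ refresh`-averaged acceptance probability of the engine's
`n`-step proposal obeys the same bound. -/
theorem sunLeapfrogProposalN_meanAcceptance_ge_integral {Cι : ℝ} (hC0 : 0 ≤ Cι) (hCι : ∀ x : E, ‖ι x‖ ≤ Cι * ‖x‖)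
    (S : (L → Matrix.specialUnitaryGroup n ℂ) → ℝ) (hS : Measurable S) (ε κ : ℝ) (hκ : 0 < κ)
    (hd : ∀ W : L → Matrix.specialUnitaryGroup n ℂ, DifferentiableAt ℝ (fun a : L → E => S (sunExpDrift ι hι ε a * W)) 0)
    (hBs : ∀ x y : E, B x y = B y x) (hBn : ∀ x : E, B x x = ‖x‖ ^ 2) {β : ℝ} (hβ0 : 0 ≤ β)
    (hBβ : ∀ x y : E, |B x y| ≤ β * ‖x‖ * ‖y‖)
    (D g : (L → Matrix.specialUnitaryGroup n ℂ) → L → E) (hDm : Measurable D)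
    (hD : ∀ (W : L → Matrix.specialUnitaryGroup n ℂ) (δ : L → E),
      fderiv ℝ (fun a : L → E => S (sunExpDrift ι hι ε a * W)) 0 δ = ∑ l, B (D W l) (δ l))
    {Dmax K : ℝ} (hD0 : 0 ≤ Dmax) (hK0 : 0 ≤ K)
    (hDb : ∀ (W : L → Matrix.specialUnitaryGroup n ℂ) (l : L), ‖D W l‖ ≤ Dmax)
    (hDK : ∀ W W' : L → Matrix.specialUnitaryGroup n ℂ, ‖D W - D W'‖ ≤ K * ‖coeConfig W - coeConfig W'‖)
    (hg : ∀ W l, g W l = -(1 / (4 * κ)) • D W l)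
    (ν : Measure (L → Matrix.specialUnitaryGroup n ℂ)) [IsProbabilityMeasure ν] (N : ℕ) :
    1 - N * (β * K * ((Fintype.card n : ℝ) ^ 2 * Cι * |ε|)) *
        ((Fintype.card L : ℝ) ^ 2 * (Module.finrank ℝ E / (2 * κ)) +
          ((2 * N + 1) * (Dmax / (4 * κ)) + (2 * N + 1) * (Fintype.card L * (Dmax / (4 * κ))) + Fintype.card L * Dmax / (8 * κ)) *
            (Fintype.card L * Real.sqrt (Module.finrank ℝ E / (2 * κ))) +
          (2 * N + 1) * (Dmax / (4 * κ)) * ((2 * N + 1) * (Fintype.card L * (Dmax / (4 * κ))) + Fintype.card L * Dmax / (8 * κ))) ≤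
      ∫ q, ∫ p, min 1 (Real.exp (-((S (sunLeapfrogProposalN ι hι ε g N (q, p)).1 +
          κ * ∑ l, ‖(sunLeapfrogProposalN ι hι ε g N (q, p)).2 l‖ ^ 2) - (S q + κ * ∑ l, ‖p l‖ ^ 2))))
        ∂(sunMomentumLaw (L := L) μ fun p => κ * ∑ l, ‖p l‖ ^ 2) ∂ν := by
  haveI := isProbabilityMeasure_sunMomentumLaw_normSq (L := L) μ hκ
  have hpt := fun q => sunLeapfrogProposalN_meanAcceptance_ge μ ι hι B hC0 hCι S hS ε κ hκ hd hBs hBn hβ0 hBβ D g hDm hD hD0 hK0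
    hDb hDK hg q N
  -- joint measurability of the acceptance probability
  have hgfun : g = fun W l => -(1 / (4 * κ)) • D W l := funext fun W => funext fun l => hg W l
  have hgm : Measurable g := by rw [hgfun]; exact hDm.const_smul (-(1 / (4 * κ)))
  have hΨ : Measurable (⇑(sunLeapfrogProposalN ι hι ε g N)) := measurable_sunLeapfrogProposalN ι hι ε N hgm
  have hT : Measurable fun p : L → E => κ * ∑ l, ‖p l‖ ^ 2 := measurable_normSqKinetic κ
  have hjoint : Measurable fun z : (L → Matrix.specialUnitaryGroup n ℂ) × (L → E) =>
      min 1 (Real.exp (-((S (sunLeapfrogProposalN ι hι ε g N z).1 + κ * ∑ l, ‖(sunLeapfrogProposalN ι hι ε g N z).2 l‖ ^ 2) -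
        (S z.1 + κ * ∑ l, ‖z.2 l‖ ^ 2)))) :=
    measurable_const.min ((((hS.comp (measurable_fst.comp hΨ)).add (hT.comp (measurable_snd.comp hΨ))).sub
      ((hS.comp measurable_fst).add (hT.comp measurable_snd))).neg.exp)
  have hF : Integrable (fun q : L → Matrix.specialUnitaryGroup n ℂ => ∫ p, min 1 (Real.exp (-((S (sunLeapfrogProposalN ι hι ε g N (q, p)).1 +
          κ * ∑ l, ‖(sunLeapfrogProposalN ι hι ε g N (q, p)).2 l‖ ^ 2) - (S q + κ * ∑ l, ‖p l‖ ^ 2))))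
        ∂(sunMomentumLaw (L := L) μ fun p => κ * ∑ l, ‖p l‖ ^ 2)) ν := by
    refine (integrable_const (1 : ℝ)).mono' (hjoint.stronglyMeasurable.integral_prod_right'
      (ν := sunMomentumLaw (L := L) μ fun p => κ * ∑ l, ‖p l‖ ^ 2)).aestronglyMeasurable (Filter.Eventually.of_forall fun q => ?_)
    refine (norm_integral_le_of_norm_le_const (C := 1) (Filter.Eventually.of_forall fun p => ?_)).trans ?_
    · rw [Real.norm_eq_abs, abs_of_nonneg (le_min zero_le_one (Real.exp_pos _).le)]
      exact min_le_left _ _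
    · rw [probReal_univ, mul_one]
  calc _ = ∫ _q : L → Matrix.specialUnitaryGroup n ℂ, (1 - N * (β * K * ((Fintype.card n : ℝ) ^ 2 * Cι * |ε|)) *
        ((Fintype.card L : ℝ) ^ 2 * (Module.finrank ℝ E / (2 * κ)) +
          ((2 * N + 1) * (Dmax / (4 * κ)) + (2 * N + 1) * (Fintype.card L * (Dmax / (4 * κ))) + Fintype.card L * Dmax / (8 * κ)) *
            (Fintype.card L * Real.sqrt (Module.finrank ℝ E / (2 * κ))) +
          (2 * N + 1) * (Dmax / (4 * κ)) * ((2 * N + 1) * (Fintype.card L * (Dmax / (4 * κ))) + Fintype.card L * Dmax / (8 * κ)))) ∂ν := by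
          rw [integral_const, probReal_univ, one_smul]
    _ ≤ _ := integral_mono (integrable_const _) hF hpt

end MeanAcceptance

end Summit.Ventures.LatticeQCDFlow.Exactness
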